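import Summits.NavierStokesRegularity.NavierStokesRegularity.Theses.CoreLogGas
import HarnessLib.Audit

/-!
# Birth skeleton (BC3) of the crux `CoreLogGas.LocallyDrivenIsTypeI` (crux A of route CoreLogGas)

Crux item `stmt-NavierStokesRegularity-11290` (rank 3, route `route-NavierStokesRegularity-CoreLogGas`, card
`filament-loggas-drainage-law`); tree path `Cruxes/LocallyDrivenIsTypeI/Lines/birth.lean`; registrar
`planner-skel-stmt-NavierStokesRegularity-11290-0`, 2026-08-17 (the route predates the Lean birth certificate; this file
supplies BC3 retroactively). No `Disproof.lean` exists for this crux yet (`ledger crux ls`: no workfiles at registration).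

THE CRUX (A). For a maximal finite-energy classical solution `(u, p)` of unforced NS on `ℝ³ × [0,T)` from a rapidly
decaying datum, the LOCALITY hypothesis `H(M, t₀, g)` — at every deep near-maximum point `x` of `|ω(t)|` with a
near-largest inscribed quarter-max ball `B(x, ρ)` ("core radius"), the symmetric velocity gradient induced at `x` by the
vorticity OUTSIDE `B(x, Mρ)` is `≤ g(t)`, `∫ g < ∞` — forces the Type-I rate `‖u(t)‖∞ ≤ C / √(T − t)`.

THE CUT (the card's own mechanism, "Kelvin budget": under `H` the velocity near the peak is induced by local vorticity of
bounded flux `Γ₀` at distances `≳ a`, `|u| ≲ Γ₀ / a`, and self/mutual induction closes lengths no faster than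
`a(t)² ≳ c (T − t)`), written over the crux's OWN vocabulary only (`Ω(t) := ⨆ z ‖curl (u t) z‖`, deep points
`Ω ≤ 2‖ω(t,x)‖`, inscribed quarter-max balls `ball x ρ ⊆ {Ω ≤ 4‖ω(t,·)‖}`), every stub under EXACTLY the crux's
hypotheses (same binder text, so the composition passes them through verbatim):

* `stub_fluxBudget` [L; CORE FLUX BUDGET — Helmholtz/Kelvin]: `∃ Γ₀ t₁, ∀ t ∈ [t₁,T)`, every inscribed quarter-max ball
  `B(x, ρ)` at a deep point has `Ω(t) · ρ² ≤ Γ₀` (the vorticity flux through a core cross-section stays bounded up to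
  `T`). Why plausibly true: `Ω ρ²` is the circulation of the core, a Helmholtz invariant of the tube under Euler
  stretching (external strain shrinks `A` and raises `Ω` at fixed `ΩA`); viscosity only diffuses flux; energy alone
  already gives `Ω ρ² ≲ E₀^{1/2} ρ^{-1/2}` for an aligned core. Why it might fail: flux is NOT a conserved quantity of
  NS — co-rotating cores MERGE (flux adds) and reconnect (YaoHussain2020); a merger cascade inside `M` core radii is
  'locally driven' with unbounded flux (Tao2016AveragedNS §5 cascade geometry) — the crux's own recorded risk.
* `stub_parabolicCore` [XL; NO SUPER-PARABOLIC PINCHING — the log-gas / collapse law, where `H` is load-bearing]: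
  `∃ c > 0, t₁, ∀ t ∈ [t₁,T)` there is a deep point with an inscribed quarter-max ball of radius `ρ² ≥ c (T − t)`.
  Why plausibly true: under integrable external strain the core log-gas has no vacuum (`LogGasNoVacuum`, proved support
  stmt-2089: `A ≥ 16κ e^{−St}/(M₀+2Ft)²`, no pinch at all for a lone tube), and interacting cores close distances at
  the circulation rate `d² ~ Γ (T − t)` (Klein–Majda–Damodaran pair collapse, MajdaBertozzi2002 PDF pp. 258–261;
  Banica–Faou–Miot self-similar collisions; DNS `δ = A±(Γ|t−t₀|)^{1/2}`, arXiv:2006.05796 p. 3). Why it might fail: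
  parabolic smoothing only guarantees `ρ ≳ Ω^{-1/2}`, so the stub EXCLUDES Type-II-fast concentration of the peak
  region — for a blob relaying to ever smaller daughter blobs (Tao cascade) `ρ² ≪ T − t`. HARDEST STUB.
* `stub_kelvinInduction` [L; LOCAL INDUCTION — velocity² ≤ circulation × peak vorticity]: `∃ C t₁, ∀ t ∈ [t₁,T) ∀ x`,
  `‖u(t,x)‖² ≤ C · Ω(t)`. Why plausibly true: under `H` the velocity at the core is the Biot–Savart field of the local
  vorticity, `|u| ≲ Ω ρ`, and `(Ωρ)² = (Ωρ²) Ω ≤ Γ₀ Ω`; away from the cores `u` stays bounded while `Ω → ∞` (BKM).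
  This is the stub that USES FINITE ENERGY: the refuters' certified obstruction `dropFiniteEnergy_false`
  (evidence Evidence11031.lean on this item: `u = (1−t)⁻¹ e₀` is classical, maximal, satisfies `H` vacuously, not
  Type I) has `Ω ≡ 0`, `u ≠ 0`, so it violates exactly this stub and no other — any proof must spend
  `IsLerayHopfOn` / decay here. Why it might fail: a secondary structure whose local circulation `u²/Ω_loc` grows
  without bound (again the cascade), or velocity generated irrotationally (excluded in `L²`).

COMPOSITION (real, ≈ 30 lines of real analysis, this file): `LocallyDrivenIsTypeI_of : LocallyDrivenIsTypeI` — the ONLY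
theorem here concluding the crux, BY NAME, with no hypotheses; it calls the three stubs by name and then: fix
`t ∈ [max tᵢ, T)` (a left neighbourhood of `T`, `Ico_mem_nhdsLT`), take the parabolic core `(x₀, ρ)`, `c (T−t) ≤ ρ²`;
the flux budget gives `Ω ≤ Γ₀/ρ² ≤ Γ₀/(c (T−t))`; local induction gives `‖u(t,x)‖² ≤ C Ω ≤ (C Γ₀ / c)/(T − t)`; square
roots: `‖u(t,x)‖ ≤ √(CΓ₀/c) / √(T−t)`, i.e. `IsTypeIBlowup u T` with constant `√(C Γ₀ / c)`. `lean check`: rc 0,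
sorries = the 3 stubs (one `declaration uses sorry` warning each), nothing else; `LocallyDrivenIsTypeI_of` itself has no
direct placeholder (its closed twin with the stub statements as hypotheses is sorry-free, whitelist axioms — below).

BC3 PROBES (registrar folder `bc/probes.lean`, `bc/probesA.lean`, `bc/probesB.lean`; `lean check`, 400 000 heartbeats
per attempt): for each stub statement `S` (verbatim the signature of `stub_X`, as a `def S : Prop`), the goals
`S → LocallyDrivenIsTypeI` and `S → NavierStokesRegularity` FAIL under every probe tactic — `exact?`: "could not close
the goal" (12/12, with and without `intro`); `simpa [S]`: heartbeat timeout at `whnf` (6/6); `unfold S; simpa`: timeout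
(6/6); `aesop`: "failed to prove the goal after exhaustive search" (6/6); `intro h; unfold S at h; aesop`: timeout
(6/6); the combined `first | exact? | simpa [S] | (unfold S; simpa) | aesop`: rc 1 (6/6). No stub is cheaply the crux
or the summit. Design note: the vorticity Type-I rate `Ω ≤ C₁/(T−t)` is deliberately NOT a stub (it is DERIVED inside
the composition from flux budget × parabolic core), so no stub is itself a blow-up-rate statement.

CLOSED TWIN (registrar evidence `bc/LocallyDrivenIsTypeI_birth_closed.lean`, attached to the crux item): the same
composition with the three stub signatures written out as hypotheses — rc 0, 0 sorries, 0 warnings, axioms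
{propext, Classical.choice, Quot.sound}.
-/

noncomputable section

open Set MeasureTheory Filter Topology

namespace Summit.NavierStokesRegularity.NavierStokesRegularity.Cruxes.LocallyDrivenIsTypeI.Birth

set_option linter.unusedVariables false
set_option linter.dupNamespace false

/-- **stub 1 — `stub_fluxBudget` (L; core flux budget, Helmholtz/Kelvin).** Under the crux's hypotheses (maximal
finite-energy classical solution from Clay data + locality `H`): there are `Γ₀ > 0` and `t₁ < T` such that for every
`t ∈ [t₁, T)`, every deep point `x` (`Ω(t) ≤ 2‖ω(t,x)‖`) and every inscribed quarter-max ball `ball x ρ`,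
`Ω(t) · ρ² ≤ Γ₀`. Sources: Helmholtz flux invariance (MajdaBertozzi2002 §1.6–1.8), LundgrenAshurst1989,
YaoHussain2020 (why it might fail: flux growth through merger/reconnection). -/
theorem stub_fluxBudget :
    ∀ (ν T : ℝ), 0 < ν → 0 < T →
    ∀ (u : ℝ → EuclideanSpace ℝ (Fin 3) → EuclideanSpace ℝ (Fin 3)) (p : ℝ → EuclideanSpace ℝ (Fin 3) → ℝ),
    Literature.Analysis.FluidPDE.IsMaximalSmoothSolution ν 0 u p T →
    Literature.Analysis.FluidPDE.IsLerayHopfOn T ν 0 (u 0) u →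
    Literature.Analysis.FluidPDE.HasRapidSpatialDecay (u 0) →
    (∃ (M t₀ : ℝ) (g : ℝ → ℝ), 1 ≤ M ∧ 0 ≤ t₀ ∧ t₀ < T ∧ MeasureTheory.IntegrableOn g (Set.Ico t₀ T) ∧
      ∀ t ∈ Set.Ico t₀ T, ∀ (x : EuclideanSpace ℝ (Fin 3)) (ρ : ℝ), 0 < ρ →
        (⨆ z, ‖Literature.Analysis.FluidPDE.curl (u t) z‖) ≤ 2 * ‖Literature.Analysis.FluidPDE.curl (u t) x‖ →
        Metric.ball x ρ ⊆ {y | (⨆ z, ‖Literature.Analysis.FluidPDE.curl (u t) z‖) ≤ 4 * ‖Literature.Analysis.FluidPDE.curl (u t) y‖} →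
        (∀ (x' : EuclideanSpace ℝ (Fin 3)) (ρ' : ℝ),
          (⨆ z, ‖Literature.Analysis.FluidPDE.curl (u t) z‖) ≤ 2 * ‖Literature.Analysis.FluidPDE.curl (u t) x'‖ →
          Metric.ball x' ρ' ⊆ {y | (⨆ z, ‖Literature.Analysis.FluidPDE.curl (u t) z‖) ≤ 4 * ‖Literature.Analysis.FluidPDE.curl (u t) y‖} →
          ρ' ≤ 2 * ρ) →
        ∀ e : EuclideanSpace ℝ (Fin 3), ‖e‖ = 1 →
          |inner ℝ ((fderiv ℝ (u t) x - fderiv ℝ (fun z : EuclideanSpace ℝ (Fin 3) =>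
            ∫ y, (4 * Real.pi * ‖z - y‖ ^ 3)⁻¹ • Literature.Analysis.FluidPDE.cross
              ((Metric.ball x (M * ρ)).indicator (Literature.Analysis.FluidPDE.curl (u t)) y) (z - y)) x) e) e| ≤ g t) →
    ∃ (Γ₀ t₁ : ℝ), 0 < Γ₀ ∧ t₁ < T ∧ ∀ t ∈ Set.Ico t₁ T, ∀ (x : EuclideanSpace ℝ (Fin 3)) (ρ : ℝ), 0 < ρ →
      (⨆ z, ‖Literature.Analysis.FluidPDE.curl (u t) z‖) ≤ 2 * ‖Literature.Analysis.FluidPDE.curl (u t) x‖ →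
      Metric.ball x ρ ⊆ {y | (⨆ z, ‖Literature.Analysis.FluidPDE.curl (u t) z‖) ≤ 4 * ‖Literature.Analysis.FluidPDE.curl (u t) y‖} →
      (⨆ z, ‖Literature.Analysis.FluidPDE.curl (u t) z‖) * ρ ^ 2 ≤ Γ₀ := by
  sorry

/-- **stub 2 — `stub_parabolicCore` (XL; no super-parabolic pinching of the core — HARDEST, `H` load-bearing).**
Under the crux's hypotheses: there are `c > 0` and `t₁ < T` such that for every `t ∈ [t₁, T)` some deep point `x`
carries an inscribed quarter-max ball of radius `ρ` with `c · (T − t) ≤ ρ²`. Sources: LogGasNoVacuum (stmt-2089,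
proved), KleinMajdaDamodaran1995 / MajdaBertozzi2002 PDF pp. 258–261 (pair collapse `d² ~ Γ(T−t)`),
BanicaFaouMiot2016, arXiv:2006.05796 p. 3; why it might fail: Tao2016AveragedNS §5 (daughter-blob cascade,
`ρ² ≪ T − t`). -/
theorem stub_parabolicCore :
    ∀ (ν T : ℝ), 0 < ν → 0 < T →
    ∀ (u : ℝ → EuclideanSpace ℝ (Fin 3) → EuclideanSpace ℝ (Fin 3)) (p : ℝ → EuclideanSpace ℝ (Fin 3) → ℝ),
    Literature.Analysis.FluidPDE.IsMaximalSmoothSolution ν 0 u p T →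
    Literature.Analysis.FluidPDE.IsLerayHopfOn T ν 0 (u 0) u →
    Literature.Analysis.FluidPDE.HasRapidSpatialDecay (u 0) →
    (∃ (M t₀ : ℝ) (g : ℝ → ℝ), 1 ≤ M ∧ 0 ≤ t₀ ∧ t₀ < T ∧ MeasureTheory.IntegrableOn g (Set.Ico t₀ T) ∧
      ∀ t ∈ Set.Ico t₀ T, ∀ (x : EuclideanSpace ℝ (Fin 3)) (ρ : ℝ), 0 < ρ →
        (⨆ z, ‖Literature.Analysis.FluidPDE.curl (u t) z‖) ≤ 2 * ‖Literature.Analysis.FluidPDE.curl (u t) x‖ →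
        Metric.ball x ρ ⊆ {y | (⨆ z, ‖Literature.Analysis.FluidPDE.curl (u t) z‖) ≤ 4 * ‖Literature.Analysis.FluidPDE.curl (u t) y‖} →
        (∀ (x' : EuclideanSpace ℝ (Fin 3)) (ρ' : ℝ),
          (⨆ z, ‖Literature.Analysis.FluidPDE.curl (u t) z‖) ≤ 2 * ‖Literature.Analysis.FluidPDE.curl (u t) x'‖ →
          Metric.ball x' ρ' ⊆ {y | (⨆ z, ‖Literature.Analysis.FluidPDE.curl (u t) z‖) ≤ 4 * ‖Literature.Analysis.FluidPDE.curl (u t) y‖} →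
          ρ' ≤ 2 * ρ) →
        ∀ e : EuclideanSpace ℝ (Fin 3), ‖e‖ = 1 →
          |inner ℝ ((fderiv ℝ (u t) x - fderiv ℝ (fun z : EuclideanSpace ℝ (Fin 3) =>
            ∫ y, (4 * Real.pi * ‖z - y‖ ^ 3)⁻¹ • Literature.Analysis.FluidPDE.cross
              ((Metric.ball x (M * ρ)).indicator (Literature.Analysis.FluidPDE.curl (u t)) y) (z - y)) x) e) e| ≤ g t) →
    ∃ (c t₁ : ℝ), 0 < c ∧ t₁ < T ∧ ∀ t ∈ Set.Ico t₁ T, ∃ (x : EuclideanSpace ℝ (Fin 3)) (ρ : ℝ), 0 < ρ ∧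
      (⨆ z, ‖Literature.Analysis.FluidPDE.curl (u t) z‖) ≤ 2 * ‖Literature.Analysis.FluidPDE.curl (u t) x‖ ∧
      Metric.ball x ρ ⊆ {y | (⨆ z, ‖Literature.Analysis.FluidPDE.curl (u t) z‖) ≤ 4 * ‖Literature.Analysis.FluidPDE.curl (u t) y‖} ∧
      c * (T - t) ≤ ρ ^ 2 := by
  sorry

/-- **stub 3 — `stub_kelvinInduction` (L; local induction: velocity² ≤ circulation × peak vorticity; the stub
that uses finite energy).** Under the crux's hypotheses: there are `C > 0` and `t₁ < T` with
`‖u(t,x)‖² ≤ C · Ω(t)` for all `t ∈ [t₁, T)` and all `x`. Sources: Biot–Savart near-field estimate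
(MajdaBertozzi2002 Prop. 2.1 ff.), BealeKatoMajda1984 (`Ω → ∞`), refuter evidence Evidence11031.lean
`dropFiniteEnergy_false` on stmt-11290 (the finite-energy hypotheses are load-bearing exactly here); why it might
fail: unbounded local circulation in a cascade (Tao2016AveragedNS §5). -/
theorem stub_kelvinInduction :
    ∀ (ν T : ℝ), 0 < ν → 0 < T →
    ∀ (u : ℝ → EuclideanSpace ℝ (Fin 3) → EuclideanSpace ℝ (Fin 3)) (p : ℝ → EuclideanSpace ℝ (Fin 3) → ℝ),
    Literature.Analysis.FluidPDE.IsMaximalSmoothSolution ν 0 u p T →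
    Literature.Analysis.FluidPDE.IsLerayHopfOn T ν 0 (u 0) u →
    Literature.Analysis.FluidPDE.HasRapidSpatialDecay (u 0) →
    (∃ (M t₀ : ℝ) (g : ℝ → ℝ), 1 ≤ M ∧ 0 ≤ t₀ ∧ t₀ < T ∧ MeasureTheory.IntegrableOn g (Set.Ico t₀ T) ∧
      ∀ t ∈ Set.Ico t₀ T, ∀ (x : EuclideanSpace ℝ (Fin 3)) (ρ : ℝ), 0 < ρ →
        (⨆ z, ‖Literature.Analysis.FluidPDE.curl (u t) z‖) ≤ 2 * ‖Literature.Analysis.FluidPDE.curl (u t) x‖ →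
        Metric.ball x ρ ⊆ {y | (⨆ z, ‖Literature.Analysis.FluidPDE.curl (u t) z‖) ≤ 4 * ‖Literature.Analysis.FluidPDE.curl (u t) y‖} →
        (∀ (x' : EuclideanSpace ℝ (Fin 3)) (ρ' : ℝ),
          (⨆ z, ‖Literature.Analysis.FluidPDE.curl (u t) z‖) ≤ 2 * ‖Literature.Analysis.FluidPDE.curl (u t) x'‖ →
          Metric.ball x' ρ' ⊆ {y | (⨆ z, ‖Literature.Analysis.FluidPDE.curl (u t) z‖) ≤ 4 * ‖Literature.Analysis.FluidPDE.curl (u t) y‖} →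
          ρ' ≤ 2 * ρ) →
        ∀ e : EuclideanSpace ℝ (Fin 3), ‖e‖ = 1 →
          |inner ℝ ((fderiv ℝ (u t) x - fderiv ℝ (fun z : EuclideanSpace ℝ (Fin 3) =>
            ∫ y, (4 * Real.pi * ‖z - y‖ ^ 3)⁻¹ • Literature.Analysis.FluidPDE.cross
              ((Metric.ball x (M * ρ)).indicator (Literature.Analysis.FluidPDE.curl (u t)) y) (z - y)) x) e) e| ≤ g t) →
    ∃ (C t₁ : ℝ), 0 < C ∧ t₁ < T ∧ ∀ t ∈ Set.Ico t₁ T, ∀ (x : EuclideanSpace ℝ (Fin 3)),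
      ‖u t x‖ ^ 2 ≤ C * (⨆ z, ‖Literature.Analysis.FluidPDE.curl (u t) z‖) := by
  sorry

/-! ### The composition (real proof; no placeholder below this line) -/

/-- **The skeleton theorem = the composition** (A12 layer invariant: concludes the crux `LocallyDrivenIsTypeI` BY NAME,
no hypotheses, placeholders only inside the three declared stubs, which it uses by name). Flux budget × parabolic core ×
local induction: for `t ∈ [max tᵢ, T)` pick the parabolic core `(x₀, ρ)`, `c (T − t) ≤ ρ²`; then
`Ω(t) ≤ Γ₀ / ρ² ≤ Γ₀ / (c (T − t))` and `‖u(t,x)‖² ≤ C Ω(t) ≤ (C Γ₀ / c) / (T − t)`, whence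
`‖u(t,x)‖ ≤ √(C Γ₀ / c) / √(T − t)`: `IsTypeIBlowup u T` with constant `√(C Γ₀ / c)`. The twin with the three stub
STATEMENTS as explicit hypotheses (`<sig₁> → <sig₂> → <sig₃> → LocallyDrivenIsTypeI`, same proof, no placeholder at all,
axioms {propext, Classical.choice, Quot.sound}) is the registrar's evidence file `bc/LocallyDrivenIsTypeI_birth_closed.lean`.
When the three stubs land (`propose --supports stmt-NavierStokesRegularity-11290`, matching the registered names +
signatures), this file with their proofs substituted IS the crux proof. -/
theorem LocallyDrivenIsTypeI_of : Theses.CoreLogGas.LocallyDrivenIsTypeI := by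
  intro ν T hν hT u p hmax hlh hdec hH
  obtain ⟨Γ₀, t₁, hΓ₀, ht₁, hflux⟩ := stub_fluxBudget ν T hν hT u p hmax hlh hdec hH
  obtain ⟨c, t₂, hc, ht₂, hcore⟩ := stub_parabolicCore ν T hν hT u p hmax hlh hdec hH
  obtain ⟨C, t₃, hC, ht₃, hvel⟩ := stub_kelvinInduction ν T hν hT u p hmax hlh hdec hH
  refine ⟨Real.sqrt (C * Γ₀ / c), ?_⟩
  have hstar : max (max t₁ t₂) t₃ < T := max_lt (max_lt ht₁ ht₂) ht₃
  filter_upwards [Ico_mem_nhdsLT hstar] with t ht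
  intro x
  have h₁ : t₁ ≤ t := le_trans (le_trans (le_max_left t₁ t₂) (le_max_left _ t₃)) ht.1
  have h₂ : t₂ ≤ t := le_trans (le_trans (le_max_right t₁ t₂) (le_max_left _ t₃)) ht.1
  have h₃ : t₃ ≤ t := le_trans (le_max_right _ t₃) ht.1
  have htT : t < T := ht.2
  have hTt : 0 < T - t := sub_pos.mpr htT
  obtain ⟨x₀, ρ, hρ, hdeep, hins, hρT⟩ := hcore t ⟨h₂, htT⟩
  have hΩρ := hflux t ⟨h₁, htT⟩ x₀ ρ hρ hdeep hins
  have hux := hvel t ⟨h₃, htT⟩ x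
  have hρ2 : 0 < ρ ^ 2 := by positivity
  have hcT : 0 < c * (T - t) := mul_pos hc hTt
  have hΩle : (⨆ z, ‖Literature.Analysis.FluidPDE.curl (u t) z‖) ≤ Γ₀ / (c * (T - t)) := by
    have h1 : (⨆ z, ‖Literature.Analysis.FluidPDE.curl (u t) z‖) ≤ Γ₀ / ρ ^ 2 := by
      rw [le_div_iff₀ hρ2]
      exact hΩρ
    exact h1.trans (div_le_div_of_nonneg_left hΓ₀.le hcT hρT)
  have hsq : ‖u t x‖ ^ 2 ≤ (C * Γ₀ / c) / (T - t) := by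
    calc ‖u t x‖ ^ 2 ≤ C * (⨆ z, ‖Literature.Analysis.FluidPDE.curl (u t) z‖) := hux
      _ ≤ C * (Γ₀ / (c * (T - t))) := mul_le_mul_of_nonneg_left hΩle hC.le
      _ = (C * Γ₀ / c) / (T - t) := by rw [div_div, mul_div_assoc]
  have hK0 : 0 ≤ C * Γ₀ / c := by positivity
  calc ‖u t x‖ = Real.sqrt (‖u t x‖ ^ 2) := (Real.sqrt_sq (norm_nonneg _)).symm
    _ ≤ Real.sqrt ((C * Γ₀ / c) / (T - t)) := Real.sqrt_le_sqrt hsq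
    _ = Real.sqrt (C * Γ₀ / c) / Real.sqrt (T - t) := Real.sqrt_div hK0 _

end Summit.NavierStokesRegularity.NavierStokesRegularity.Cruxes.LocallyDrivenIsTypeI.Birth
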